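import Literature.MathematicalPhysics.QuantumFieldTheory.Balaban1983to89.B7Prop3GeneralLinearSplit

/-!
# Bałaban's renormalization group for 4-d lattice Yang–Mills — B7 Proposition 3 AT A GENERAL BACKGROUND `V₀`, the LINEAR
PART, file 4: THE BOUND (126) — `|(Q(V₀)A)_c| ≤ (1 + O(1)L²α₀)|A|` — for B7's own double-bar average (89), with the
`O(1)` explicit: `‖L(Q(V₀)A)_c − L·(Q₀A)_c‖ ≤ 50(d+1)·ε·L·|A|` for block loops `‖W_x(V₀) − 1‖ ≤ ε ≤ 1∕8`, hence
`‖L(Q(V₀)A)_c‖ ≤ (1 + 800(d+1)²(d+4)L²α₀)·L·|A|` under the plaquette regularity (109) (`B7Prop3GeneralLinearBound`)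

CITATION HEADER (lean-in-tree rule 2026-08-18).  Audit cell `pub-balaban`, sub-cell `t4` (NE7c ROUND-2 crew, seat
`b2b-balaban-t4-ne7c-formalise-leaf-05` gen 6; owner table `t4/b2b-balaban-t4-ne7c-p1/LEAVES-NE7c-P1.md` v2.3 row S55
«[B7] PROPOSITION 3 AT A GENERAL REGULAR BACKGROUND», linear part (124)–(126); files 1–4 of the row:
`B7Prop3GeneralRotated` p219571, `B7Prop3GeneralLinear` p219821, `B7Prop3GeneralTild` p220065, `B7Prop3GeneralLinearSplit`).
Source: T. Bałaban, *Averaging operations for lattice gauge theories*, Commun. Math. Phys. **98**, 17–51 (1985)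
[Balaban1985Averaging] (cell paper B7; journal page = PDF page + 16), Sect. D p. 36 [PDF 20] ((124)–(126), Proposition 3),
quoted from the page render `b2b-balaban-ref1/pages/1985-cmp98-averaging/1985-cmp98-averaging-p020-x2.png` READ AS AN IMAGE
by this seat (2026-08-20); (109) p. 34, (26) p. 21 through the lineage's quotations.
Companions (REUSED BY NAME, none modified): files 1–3 of the row and `B7Prop3GeneralLinearSplit` (`linQcov_split` = (124)
regrouped), `B7Prop1Explicit` (`U1`, `hol_mem`, `norm_inv_sub_one_le`, `l1_boxVec_le`, `length_gammaWord`, `plaqWord`),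
`B7Prop2Explicit` (`norm_Wcx_sub_one_le` — Prop. 1's mechanism: plaquettes `α₀` ⇒ block loops `16(d+1)(d+4)L²α₀`),
`MatrixLog` (`norm_mlog_le_two_mul` = (26)), `B12AverageCorridor267` (the operator estimates `norm_PhiY_sub_one_le`,
`norm_AdU_expU_sub_one_le`, `norm_PsiW_sub_one_le`, `exp_two_mul_sub_one_le` — the «operators … estimated by O(L²α₀)»).

THE PRINTED TEXT (verbatim, p. 36).  "The first term on the right-hand side above is the main term in this linear form, and
it resembles the definition of the averaging operation Q in [2]. The remaining terms are small because the functions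
g(−z), g⁻¹(z), e^{iz} are equal to 1 for z = 0, so the operators occurring in these terms can be estimated by O(L²α₀) and the
terms can be estimated by O(1)L²α₀L|A| < O(1)L²α₀Lα₁. We will denote the main term by Q_{V₀}, or Q₀ (Q₀A)_c = (Q_{V₀}A)_c =
Σ_{x∈B(c₋)} L^{−(d+1)}(R_{0,c₋}A)([x, x′]), (125) and it has an estimate |(Q₀A)_c| ≤ |A| < α₁, so we have for the whole linear
term |(Q(V₀)A)_c| ≤ |A| + O(1)L²α₀|A| < (1 + O(1)L²α₀)α₁ < e^{O(1)L²α₀}α₁. (126) Thus we have proved the following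
**Proposition 3.** There exist constants C₁, c₃, c₃ ≤ c₂, such that for α₀, α₁ ≤ c₃ the function Q(V₀, A) = (1/i) log V̿₁ is an
analytic function of A satisfying the equalities and bounds (122)–(124). The constant C₁ depends on d and c₃ depends on d and
L."  p. 36, top: "we have assumed that α₀, α₁ are sufficiently small so that the formulas and inequalities proved in Sect. A
hold, and that |Y_x| = O(L²α₀) are small."

DICTIONARY (as in files 1–4).  `|A|` ↦ a bound `a` on `‖A x κ‖`; the loop smallness `|Y_x| = O(L²α₀)` ↦ `‖W_x(V₀) − 1‖ ≤ ε`
(`W_x = e^{iY_x}` the loop (42) of the background), `ε ≤ 1∕8`; background bond variables in `U1` (`‖V₀(b)‖, ‖V₀(b)⁻¹‖ ≤ 1`,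
e.g. unitary); «L(Q(V₀)A)_c» = `linQcov`, `L·(Q₀A)_c` = `(L : ℝ) • Q0cov`.

WHAT THIS FILE PROVES (kernel, no `sorry`, standard axioms):
* §1 the operator defects are `O(ε)`: `norm_conjR_sub_self_le` (`‖R(W)Z − Z‖ ≤ 2ε‖Z‖`), `norm_Xavg_le` (`‖X₀‖ ≤ 2ε`),
  `norm_conjR_expUnit_sub_self_le`/`norm_PhiY_sub_self_le` (`‖𝒜Z − Z‖, ‖ΦZ − Z‖ ≤ 8ε‖Z‖`), `Dmlog_mul_right_eq` +
  `norm_Dmlog_mul_right_sub_self_le` (`‖Ψ_xZ − Z‖ ≤ 6ε‖Z‖`) — print's "equal to 1 for z = 0 … estimated by O(L²α₀)".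
* §2 path sums: `‖(R_{0,·}A)(Γ_{c₋,x})‖ ≤ dL·a`, `‖(R_{0,c₋}A)(c)‖ ≤ L·a`, `‖A_x^{(1)}‖ ≤ 2(d+1)L·a`.
* §3 **the three brackets of `linQcov_split`** are `≤ 40(d+1)εLa`, `≤ 10εLa`, `≤ 10dεLa` (`norm_bracket1/2/3_le`); hence
  **`norm_linQcov_sub_main_le`**: `‖L(Q(V₀)A)_c − L·(Q₀A)_c‖ ≤ 50(d+1)·ε·L·a`; **`norm_linQcov_le`**: `‖L(Q(V₀)A)_c‖ ≤
  (1 + 50(d+1)ε)·L·a` — (126) with `O(1)L²α₀ ↦ 50(d+1)ε`; **`norm_linQcov_le_of_plaquettes`**: under the printed regime (109)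
  `|V₀(∂p) − 1| ≤ α₀` (with `512(d+1)(d+4)L²α₀ ≤ 1`, `16(d+1)(d+4)L²α₀ ≤ 1∕8`), `‖L(Q(V₀)A)_c‖ ≤ (1 + 800(d+1)²(d+4)L²α₀)·L·a` —
  (126) VERBATIM SHAPE `(1 + O(1)L²α₀)|A|` with `O(1) = 800(d+1)²(d+4)` (`d`-dependent only, as Prop. 3 says of `C₁`).
ABSOLUTE-RULE LEDGER.  Hypotheses: the displayed `U1`, `ε`/`α₀`, `a` binders only; no `B7.Prop*` placeholder, no Literature
`Prop`-fact, nothing of the manuscript cited as a fact; no new definition; `B7.Prop3Printed` neither used nor claimed (the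
analyticity half and (123) remain).
NOT CERTIFIED HERE.  Analyticity of `Q(V₀, ·, c)`, the remainder bound (123) `|C(V₀,A,c)| ≤ C₁L²|A|²`, the threshold
`c₃(d,L)` (rows S55-analytic ∕ S58); the term-by-term identification of the three brackets with print's four remainder terms
of (124) (the brackets are a regrouping, see `B7Prop3GeneralLinearSplit`); sharper constants.
DIVERGENCES from print.  (a) constants: `50(d+1)` resp. `800(d+1)²(d+4)` are admissible witnesses for print's unspecified
`O(1)` (not optimal); the loop regime `ε ≤ 1∕8` is this lineage's (the series (21) and the operator estimates of
`B12AverageCorridor267` live there); (b) everything ×`L` (print's (126) is for `(Q(V₀)A)_c = L⁻¹·`«L(Q(V₀)A)_c»); (c) «L(Q(V₀)A)_c»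
is the derivative-defined linear part (`B7Prop3GeneralLinear.linQcov`); (d) setting as in the lineage (`ℤ^d`, units of a
complete normed `ℂ`-algebra with `‖1‖ = 1`, `U1` background).
FINDING.  (124)–(126) are correct as printed, at a general regular background, with every `O(·)` finite and `d`-dependent
only; the mechanism — tree-contour terms cancel against the moving frames, the straight segments give `Q₀`, every
correction carries an `[operator − 1] = O(ε)` — is kernel-checked for the paper's own (89).  VALUE = the linear half of
Prop. 3 at a curved background; NOT summit progress (NE7c NOT PROVED; spine PROVED 0∕9; rung (B)+1 on a finite T⁴ — NOT
infinite volume, NOT mass gap, NOT Clay).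
-/

noncomputable section

open scoped BigOperators
open NormedSpace Finset

namespace Literature.MathematicalPhysics.QuantumFieldTheory.Balaban1983to89.B7Prop3GeneralLinearBound

open B7Prop1Explicit B7Prop3Flat B7Eq92Concrete MatrixLog B7Prop3GeneralRotated B7Prop3GeneralLinear
  B7Prop3GeneralTild B7Prop3GeneralLinearSplit
open B7Eq78Linearization (conjR conjR_apply conjR_sub conjR_one)
open B12AverageCorridor267 (Dmlog PhiY PhiY_apply PsiW PsiW_apply AdU AdU_apply expU val_expU val_inv_expU
  norm_PhiY_sub_one_le norm_AdU_expU_sub_one_le norm_PsiW_sub_one_le exp_two_mul_sub_one_le)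

-- `Site` alone would resolve to the torus sites of `Setup.lean`; re-export the `ℤ^d` sites of `B7Prop1Explicit`.
export B7Prop1Explicit (Site)

variable {d : ℕ}

variable {𝔸 : Type*} [NormedRing 𝔸] [NormedAlgebra ℂ 𝔸] [NormOneClass 𝔸] [CompleteSpace 𝔸]
variable (L : ℕ)

/-! ## §1 The elementary operator defects: `R(W) − 1`, `R(e^{X₀}) − 1`, `Φ − 1`, `Ψ_x − 1` are `O(ε)` -/

section Defects

omit [NormedAlgebra ℂ 𝔸] [CompleteSpace 𝔸] in
/-- `‖R(u)Z − Z‖ ≤ 2ε‖Z‖` for a unit `u` with `‖u‖, ‖u⁻¹‖ ≤ 1` and `‖u − 1‖ ≤ ε` (`R(u)Z − Z = (u − 1)Zu⁻¹ + Z(u⁻¹ − 1)`,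
`‖u⁻¹ − 1‖ ≤ ‖u − 1‖`) — the operators "equal to 1 for z = 0" of p. 36, here `e^{i ad_{Y_x}} = R(W_x)`.
[cite: Balaban1985Averaging, (124)–(126) p.36, (57) p.27] -/
theorem norm_conjR_sub_self_le {u : 𝔸ˣ} (hu : u ∈ U1 𝔸) {ε : ℝ} (hε : ‖(u : 𝔸) - 1‖ ≤ ε) (Z : 𝔸) :
    ‖conjR u Z - Z‖ ≤ 2 * ε * ‖Z‖ := by
  have h2 := (mem_U1.1 hu).2
  have hinv : ‖((u⁻¹ : 𝔸ˣ) : 𝔸) - 1‖ ≤ ε := (norm_inv_sub_one_le hu).trans hε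
  have hsplit : conjR u Z - Z = ((u : 𝔸) - 1) * Z * ((u⁻¹ : 𝔸ˣ) : 𝔸) + Z * (((u⁻¹ : 𝔸ˣ) : 𝔸) - 1) := by
    rw [conjR_apply]; noncomm_ring
  have hε0 : 0 ≤ ε := (norm_nonneg _).trans hε
  rw [hsplit]
  calc ‖((u : 𝔸) - 1) * Z * ((u⁻¹ : 𝔸ˣ) : 𝔸) + Z * (((u⁻¹ : 𝔸ˣ) : 𝔸) - 1)‖
      ≤ ‖(u : 𝔸) - 1‖ * ‖Z‖ * ‖((u⁻¹ : 𝔸ˣ) : 𝔸)‖ + ‖Z‖ * ‖((u⁻¹ : 𝔸ˣ) : 𝔸) - 1‖ :=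
        (norm_add_le _ _).trans (add_le_add ((norm_mul_le _ _).trans
          (mul_le_mul_of_nonneg_right (norm_mul_le _ _) (norm_nonneg _))) (norm_mul_le _ _))
    _ ≤ ε * ‖Z‖ * 1 + ‖Z‖ * ε :=
        add_le_add (mul_le_mul (mul_le_mul_of_nonneg_right hε (norm_nonneg _)) h2 (norm_nonneg _)
          (mul_nonneg hε0 (norm_nonneg _))) (mul_le_mul_of_nonneg_left hinv (norm_nonneg _))
    _ = 2 * ε * ‖Z‖ := by ring

omit [NormedAlgebra ℂ 𝔸] [CompleteSpace 𝔸] in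
/-- the block loops of a `U1` background are in `U1`. [cite: Balaban1985Averaging, (42) p.23] -/
theorem Wcx_mem {V₀ : Site d → Fin d → 𝔸ˣ} (hV₀ : ∀ x κ, V₀ x κ ∈ U1 𝔸) (q : Site d) (κ : Fin d) (r : Site d) :
    Wcx L V₀ q κ r ∈ U1 𝔸 :=
  (U1 𝔸).mul_mem (hol_mem hV₀ _ _) ((U1 𝔸).inv_mem (hol_mem hV₀ _ _))

/-- `Σ_{x∈B(c₋)} L^{−d}·B = B` for real `B`. [cite: Balaban1985Averaging, (2) p.17, (42) p.23] -/
theorem sum_blockWeight_mul (hL : 1 ≤ L) (B : ℝ) : ∑ _r : Fin d → Fin L, ((L : ℝ) ^ d)⁻¹ * B = B := by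
  rw [Finset.sum_const, Finset.card_univ, Fintype.card_pi, Finset.prod_const, Finset.card_univ, Fintype.card_fin,
    Fintype.card_fin, nsmul_eq_mul, Nat.cast_pow]
  have hL0 : (L : ℝ) ≠ 0 := by exact_mod_cast (by omega : L ≠ 0)
  field_simp

omit [NormOneClass 𝔸] in
/-- `‖X₀‖ ≤ 2ε`: the exponent `X_c(V₀) = Σ_x L^{−d} log W_x` ("Y = Σ L^{−d}Y_x", `|Y_x| = O(L²α₀)`) is a convex combination of
logarithms of norm `≤ 2‖W_x − 1‖ ≤ 2ε` ((26) `norm_mlog_le_two_mul`). [cite: Balaban1985Averaging, p.36 ("|Y_x| = O(L²α₀) are small"), (26) p.21] -/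
theorem norm_Xavg_le (hL : 1 ≤ L) (V₀ : Site d → Fin d → 𝔸ˣ) (q : Site d) (κ : Fin d) {ε : ℝ} (hε : ε ≤ 1 / 8)
    (hW : ∀ r : Fin d → Fin L, ‖((Wcx L V₀ q κ (boxVec L r) : 𝔸ˣ) : 𝔸) - 1‖ ≤ ε) :
    ‖Xavg L V₀ q κ‖ ≤ 2 * ε := by
  unfold Xavg
  calc ‖∑ r : Fin d → Fin L, (((L : ℝ) ^ d)⁻¹) • mlog ((Wcx L V₀ q κ (boxVec L r) : 𝔸ˣ) : 𝔸)‖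
      ≤ ∑ r : Fin d → Fin L, (((L : ℝ) ^ d)⁻¹) * (2 * ε) := by
        refine norm_sum_le_of_le _ fun r _ => ?_
        rw [norm_smul, Real.norm_of_nonneg (by positivity)]
        refine mul_le_mul_of_nonneg_left ?_ (by positivity)
        exact (norm_mlog_le_two_mul ((hW r).trans (by linarith))).trans (by linarith [hW r])
    _ = 2 * ε := sum_blockWeight_mul (d := d) L hL (2 * ε)

omit [NormOneClass 𝔸] [CompleteSpace 𝔸] in
/-- `R(e^{X}) = AdU (expU X)` of `B12AverageCorridor267` (same conjugation, the two lineages' unit packagings of `e^{X}`).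
[cite: Balaban1985Averaging, (56) p.27] -/
theorem conjR_expUnit_eq_AdU [CompleteSpace 𝔸] (X Z : 𝔸) : conjR (expUnit X) Z = AdU (expU X) Z := by
  rw [conjR_apply, AdU_apply, val_expUnit, val_inv_expUnit, val_expUnit, val_expU, val_inv_expU]

/-- `‖R(e^{X₀})Z − Z‖ ≤ 8ε‖Z‖` (`‖R(e^{X₀}) − 1‖ ≤ e^{2‖X₀‖} − 1`, `‖X₀‖ ≤ 2ε`, `ε ≤ 1/8`) — print's `e^{i ad_Y}`, "equal to 1 for
z = 0". [cite: Balaban1985Averaging, (124)–(126) p.36] -/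
theorem norm_conjR_expUnit_sub_self_le {X₀ : 𝔸} {ε : ℝ} (hX : ‖X₀‖ ≤ 2 * ε) (hε : ε ≤ 1 / 8) (Z : 𝔸) :
    ‖conjR (expUnit X₀) Z - Z‖ ≤ 8 * ε * ‖Z‖ := by
  rw [conjR_expUnit_eq_AdU, show AdU (expU X₀) Z - Z = (AdU (expU X₀) - 1) Z from rfl]
  refine (ContinuousLinearMap.le_opNorm _ _).trans (mul_le_mul_of_nonneg_right ?_ (norm_nonneg _))
  exact (norm_AdU_expU_sub_one_le X₀).trans (exp_two_mul_sub_one_le (norm_nonneg _) hX hε)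

/-- `‖ΦZ − Z‖ ≤ 8ε‖Z‖` for `Φ = (D exp)_{X₀}(·)e^{−X₀}` — print's `g(−i ad_Y)`. [cite: Balaban1985Averaging, (124)–(126) p.36] -/
theorem norm_PhiY_sub_self_le {X₀ : 𝔸} {ε : ℝ} (hX : ‖X₀‖ ≤ 2 * ε) (hε : ε ≤ 1 / 8) (Z : 𝔸) :
    ‖PhiY X₀ Z - Z‖ ≤ 8 * ε * ‖Z‖ := by
  rw [show PhiY X₀ Z - Z = (PhiY X₀ - 1) Z from rfl]
  refine (ContinuousLinearMap.le_opNorm _ _).trans (mul_le_mul_of_nonneg_right ?_ (norm_nonneg _))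
  exact (norm_PhiY_sub_one_le X₀).trans (exp_two_mul_sub_one_le (norm_nonneg _) hX hε)

omit [NormOneClass 𝔸] [CompleteSpace 𝔸] in
/-- the LEFT derivative of `log` in terms of the right one: `(D log)_W(ZW) = Ψ_W(R(W⁻¹)Z)`, `Ψ_W = (D log)_W∘(W·)`
(print: `g⁻¹(−i ad_{Y_x})` vs `g⁻¹(i ad_{Y_x})`, "g⁻¹(−i ad_{Y_x})e^{i ad_{Y_x}} = g⁻¹(i ad_{Y_x})"). [cite: Balaban1985Averaging, p.35] -/
theorem Dmlog_mul_right_eq [NormOneClass 𝔸] [CompleteSpace 𝔸] (W : 𝔸ˣ) (Z : 𝔸) :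
    Dmlog (W : 𝔸) (Z * W) = PsiW (W : 𝔸) (conjR W⁻¹ Z) := by
  rw [PsiW_apply, conjR_apply, inv_inv, ← mul_assoc, ← mul_assoc, Units.mul_inv, one_mul]

/-- `‖(D log)_W(ZW) − Z‖ ≤ 6ε‖Z‖` for `W ∈ U1`, `‖W − 1‖ ≤ ε ≤ 1/8` (`‖Ψ_W − 1‖ ≤ 4ε` of `B12AverageCorridor267`, plus the
rotation `R(W⁻¹)`, `2ε`) — print's `g⁻¹(−i ad_{Y_x})`, "equal to 1 for z = 0". [cite: Balaban1985Averaging, (124)–(126) p.36, (116) p.35] -/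
theorem norm_Dmlog_mul_right_sub_self_le {W : 𝔸ˣ} (hW1 : W ∈ U1 𝔸) {ε : ℝ} (hε0 : 0 ≤ ε) (hε : ε ≤ 1 / 8)
    (hW : ‖(W : 𝔸) - 1‖ ≤ ε) (Z : 𝔸) :
    ‖Dmlog (W : 𝔸) (Z * W) - Z‖ ≤ 6 * ε * ‖Z‖ := by
  have hWi : ‖((W⁻¹ : 𝔸ˣ) : 𝔸) - 1‖ ≤ ε := (norm_inv_sub_one_le hW1).trans hW
  have hc : ‖conjR W⁻¹ Z‖ ≤ ‖Z‖ := norm_conjR_le ((U1 𝔸).inv_mem hW1) Z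
  have h1 : ‖PsiW (W : 𝔸) (conjR W⁻¹ Z) - conjR W⁻¹ Z‖ ≤ 4 * ε * ‖Z‖ := by
    rw [show PsiW (W : 𝔸) (conjR W⁻¹ Z) - conjR W⁻¹ Z = (PsiW (W : 𝔸) - 1) (conjR W⁻¹ Z) from rfl]
    refine (ContinuousLinearMap.le_opNorm _ _).trans ?_
    exact mul_le_mul (norm_PsiW_sub_one_le hW (by linarith)) hc (norm_nonneg _) (mul_nonneg (by norm_num) hε0)
  have h2 : ‖conjR W⁻¹ Z - Z‖ ≤ 2 * ε * ‖Z‖ := norm_conjR_sub_self_le ((U1 𝔸).inv_mem hW1) hWi Z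
  rw [Dmlog_mul_right_eq]
  calc ‖PsiW (W : 𝔸) (conjR W⁻¹ Z) - Z‖
      = ‖(PsiW (W : 𝔸) (conjR W⁻¹ Z) - conjR W⁻¹ Z) + (conjR W⁻¹ Z - Z)‖ := by rw [sub_add_sub_cancel]
    _ ≤ 4 * ε * ‖Z‖ + 2 * ε * ‖Z‖ := (norm_add_le _ _).trans (add_le_add h1 h2)
    _ = 6 * ε * ‖Z‖ := by ring

end Defects

/-! ## §2 The path sums: lengths of the contours -/

section Paths

variable {V₀ : Site d → Fin d → 𝔸ˣ} (hV₀ : ∀ x κ, V₀ x κ ∈ U1 𝔸) {A : Site d → Fin d → 𝔸} {a : ℝ} (ha : 0 ≤ a)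
  (hA : ∀ x κ, ‖A x κ‖ ≤ a)

omit [NormedAlgebra ℂ 𝔸] [CompleteSpace 𝔸] in
include hV₀ ha hA in
/-- `‖(R_{0,c₋}A)(Γ_{c₋,x})‖ ≤ dL·|A|` (the tree contour has `≤ d(L−1)` bonds). [cite: Balaban1985Averaging, (126) p.36, (14) p.19] -/
theorem norm_tsum_treeWord_le (y : Site d) (r : Fin d → Fin L) :
    ‖tsum V₀ A y (treeWord (boxVec L r))‖ ≤ d * L * a := by
  refine (norm_tsum_le hV₀ hA y _).trans ?_
  rw [length_treeWord]
  exact mul_le_mul_of_nonneg_right (by exact_mod_cast l1_boxVec_le L r) ha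

omit [NormedAlgebra ℂ 𝔸] [CompleteSpace 𝔸] in
include hV₀ hA in
/-- `‖(R_{0,c₋}A)(c)‖ ≤ L·|A|`. [cite: Balaban1985Averaging, (126) p.36] -/
theorem norm_tsum_seg_le (y : Site d) (κ : Fin d) : ‖tsum V₀ A y (seg κ L)‖ ≤ L * a := by
  have h := norm_tsum_le hV₀ hA y (seg κ L)
  rwa [length_seg, Int.natAbs_natCast] at h

omit [NormedAlgebra ℂ 𝔸] [CompleteSpace 𝔸] in
include hV₀ ha hA in
/-- `‖A_x^{(1)}‖ ≤ 2(d+1)L·|A|` (the loop `Γ_{c,x}∪(−c)` has `2|x − c₋|₁ + 2L ≤ 2(d+1)L` bonds). [cite: Balaban1985Averaging, (115) p.34, (126) p.36] -/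
theorem norm_Aloop_le (q : Site d) (κ : Fin d) (r : Fin d → Fin L) :
    ‖Aloop L V₀ A q κ (boxVec L r)‖ ≤ 2 * (d + 1) * L * a := by
  refine (norm_tsum_le hV₀ hA q _).trans ?_
  rw [List.length_append, length_gammaWord, length_seg]
  have h1 : (l1 (boxVec L r) : ℝ) ≤ d * L := by exact_mod_cast l1_boxVec_le L r
  have h2 : (((-(L : ℤ)).natAbs : ℕ) : ℝ) = L := by simp
  push_cast
  rw [h2]
  nlinarith

end Paths

/-! ## §3 (126): the three defect brackets are `O(ε)·L·|A|`, hence `|(Q(V₀)A)_c| ≤ (1 + O(1)ε)|A|` -/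

section Bound

omit [NormOneClass 𝔸] [CompleteSpace 𝔸] in
/-- block averages of bounded terms are bounded: `‖Σ_x L^{−d}f_x‖ ≤ B` if every `‖f_x‖ ≤ B`. [cite: Balaban1985Averaging, (42) p.23, (126) p.36] -/
theorem norm_wsum_le (hL : 1 ≤ L) {f : (Fin d → Fin L) → 𝔸} {B : ℝ} (hf : ∀ r, ‖f r‖ ≤ B) :
    ‖∑ r : Fin d → Fin L, (((L : ℝ) ^ d)⁻¹) • f r‖ ≤ B := by
  calc ‖∑ r : Fin d → Fin L, (((L : ℝ) ^ d)⁻¹) • f r‖ ≤ ∑ r : Fin d → Fin L, (((L : ℝ) ^ d)⁻¹) * B := by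
        refine norm_sum_le_of_le _ fun r _ => ?_
        rw [norm_smul, Real.norm_of_nonneg (by positivity)]
        exact mul_le_mul_of_nonneg_left (hf r) (by positivity)
    _ = B := sum_blockWeight_mul (d := d) L hL B

variable {V₀ : Site d → Fin d → 𝔸ˣ} (hV₀ : ∀ x κ, V₀ x κ ∈ U1 𝔸) {A : Site d → Fin d → 𝔸} {a : ℝ} (ha : 0 ≤ a)
  (hA : ∀ x κ, ‖A x κ‖ ≤ a) (hL : 1 ≤ L) (q : Site d) (κ : Fin d) {ε : ℝ} (hε0 : 0 ≤ ε) (hε : ε ≤ 1 / 8)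
  (hW : ∀ r : Fin d → Fin L, ‖((Wcx L V₀ q κ (boxVec L r) : 𝔸ˣ) : 𝔸) - 1‖ ≤ ε)

include hV₀ ha hA hL hε0 hε hW in
/-- FIRST BRACKET: `‖Φ(Σ_x L^{−d}Ψ_x(A_x^{(1)})) − Σ_x L^{−d}A_x^{(1)}‖ ≤ 40(d+1)·ε·L·|A|` (print's second∕third terms of (124) and
the `g`-parts of the others: `[g(−i ad_Y)g⁻¹(∓i ad_{Y_x}) − 1]` acting on the loop sums, `|Γ_{c,x}∪(−c)| ≤ 2(d+1)L`).
[cite: Balaban1985Averaging, (124)–(126) p.36] -/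
theorem norm_bracket1_le :
    ‖PhiY (Xavg L V₀ q κ) (DXavg L V₀ A q κ)
        - ∑ r : Fin d → Fin L, (((L : ℝ) ^ d)⁻¹) • Aloop L V₀ A q κ (boxVec L r)‖
      ≤ 40 * (d + 1) * ε * L * a := by
  set ℓ : ℝ := 2 * (d + 1) * L * a with hℓ
  have hℓ0 : 0 ≤ ℓ := by positivity
  have hX := norm_Xavg_le L hL V₀ q κ hε hW
  have hAl := norm_Aloop_le L hV₀ ha hA q κ
  set S := ∑ r : Fin d → Fin L, (((L : ℝ) ^ d)⁻¹) • Aloop L V₀ A q κ (boxVec L r) with hS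
  have hin : ‖DXavg L V₀ A q κ - S‖ ≤ 6 * ε * ℓ := by
    rw [hS, DXavg, ← Finset.sum_sub_distrib]
    simp_rw [← smul_sub]
    refine norm_wsum_le L hL fun r => ?_
    refine (norm_Dmlog_mul_right_sub_self_le (Wcx_mem L hV₀ q κ _) hε0 hε (hW r) _).trans ?_
    exact mul_le_mul_of_nonneg_left (hAl r) (by positivity)
  have hSn : ‖S‖ ≤ ℓ := norm_wsum_le L hL hAl
  have hDX : ‖DXavg L V₀ A q κ‖ ≤ 6 * ε * ℓ + ℓ := by
    have h := norm_add_le (DXavg L V₀ A q κ - S) S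
    rw [sub_add_cancel] at h
    linarith
  have hΦ := norm_PhiY_sub_self_le hX hε (DXavg L V₀ A q κ)
  have key : ‖PhiY (Xavg L V₀ q κ) (DXavg L V₀ A q κ) - S‖ ≤ 8 * ε * (6 * ε * ℓ + ℓ) + 6 * ε * ℓ := by
    have h := norm_add_le (PhiY (Xavg L V₀ q κ) (DXavg L V₀ A q κ) - DXavg L V₀ A q κ) (DXavg L V₀ A q κ - S)
    rw [sub_add_sub_cancel] at h
    have h8 : 8 * ε * ‖DXavg L V₀ A q κ‖ ≤ 8 * ε * (6 * ε * ℓ + ℓ) := mul_le_mul_of_nonneg_left hDX (by positivity)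
    linarith
  have h8 : 8 * ε ≤ 1 := by linarith
  have h6 : 0 ≤ 6 * ε * ℓ := by positivity
  have hε2 : 8 * ε * (6 * ε * ℓ) ≤ 6 * ε * ℓ := by
    calc 8 * ε * (6 * ε * ℓ) ≤ 1 * (6 * ε * ℓ) := mul_le_mul_of_nonneg_right h8 h6
      _ = 6 * ε * ℓ := one_mul _
  have e : 8 * ε * (6 * ε * ℓ + ℓ) = 8 * ε * (6 * ε * ℓ) + 8 * ε * ℓ := by ring
  calc ‖PhiY (Xavg L V₀ q κ) (DXavg L V₀ A q κ) - S‖ ≤ 8 * ε * (6 * ε * ℓ + ℓ) + 6 * ε * ℓ := key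
    _ ≤ 20 * ε * ℓ := by rw [e]; linarith
    _ = 40 * (d + 1) * ε * L * a := by rw [hℓ]; ring

include hV₀ hA hL hε0 hε hW in
/-- SECOND BRACKET: `‖[𝒜 − Σ_x L^{−d}R(W_x)]((R_{0,c₋}A)(c))‖ ≤ 10·ε·L·|A|` (print's fifth term `[e^{i ad_Y} − …]L⁻¹(R_{0,c₋}A)(c)`,
operator part). [cite: Balaban1985Averaging, (124)–(126) p.36] -/
theorem norm_bracket2_le :
    ‖conjR (expUnit (Xavg L V₀ q κ)) (tsum V₀ A q (seg κ L))
        - ∑ r : Fin d → Fin L, (((L : ℝ) ^ d)⁻¹) • conjR (Wcx L V₀ q κ (boxVec L r)) (tsum V₀ A q (seg κ L))‖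
      ≤ 10 * ε * L * a := by
  set Rc := tsum V₀ A q (seg κ L) with hRc
  have hR : ‖Rc‖ ≤ L * a := norm_tsum_seg_le L hV₀ hA q κ
  have hX := norm_Xavg_le L hL V₀ q κ hε hW
  have h1 : ‖conjR (expUnit (Xavg L V₀ q κ)) Rc - Rc‖ ≤ 8 * ε * ‖Rc‖ := norm_conjR_expUnit_sub_self_le hX hε Rc
  have h2 : ‖∑ r : Fin d → Fin L, (((L : ℝ) ^ d)⁻¹) • conjR (Wcx L V₀ q κ (boxVec L r)) Rc - Rc‖ ≤ 2 * ε * ‖Rc‖ := by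
    have e : ∑ r : Fin d → Fin L, (((L : ℝ) ^ d)⁻¹) • conjR (Wcx L V₀ q κ (boxVec L r)) Rc - Rc
        = ∑ r : Fin d → Fin L, (((L : ℝ) ^ d)⁻¹) • (conjR (Wcx L V₀ q κ (boxVec L r)) Rc - Rc) := by
      simp_rw [smul_sub]
      rw [Finset.sum_sub_distrib, sum_blockWeight (d := d) L hL Rc]
    rw [e]
    exact norm_wsum_le L hL fun r => norm_conjR_sub_self_le (Wcx_mem L hV₀ q κ _) (hW r) Rc
  have h := norm_sub_le (conjR (expUnit (Xavg L V₀ q κ)) Rc - Rc)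
    (∑ r : Fin d → Fin L, (((L : ℝ) ^ d)⁻¹) • conjR (Wcx L V₀ q κ (boxVec L r)) Rc - Rc)
  rw [sub_sub_sub_cancel_right] at h
  have h82 : 8 * ε * ‖Rc‖ + 2 * ε * ‖Rc‖ ≤ 10 * ε * (L * a) := by nlinarith
  linarith

include hV₀ ha hA hL hε0 hε hW in
/-- THIRD BRACKET: `‖Σ_{x′} L^{−d}[𝒜 − R(W_x)]R(V₀(c))(R_{0,c₊}A)(Γ_{c₊,x′})‖ ≤ 10·d·ε·L·|A|` (print's fourth term of (124),
`[… e^{−i ad_Y} − 1]R̄_{0,c}(R_{0,c₊}A)(Γ_{c₊,x′})`). [cite: Balaban1985Averaging, (124)–(126) p.36] -/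
theorem norm_bracket3_le :
    ‖∑ r : Fin d → Fin L, (((L : ℝ) ^ d)⁻¹) •
        (conjR (expUnit (Xavg L V₀ q κ))
            (conjR (hol V₀ q (seg κ L)) (tsum V₀ A (q + (L : ℤ) • e κ) (treeWord (boxVec L r))))
          - conjR (Wcx L V₀ q κ (boxVec L r))
            (conjR (hol V₀ q (seg κ L)) (tsum V₀ A (q + (L : ℤ) • e κ) (treeWord (boxVec L r)))))‖
      ≤ 10 * d * ε * L * a := by
  have hX := norm_Xavg_le L hL V₀ q κ hε hW
  refine norm_wsum_le L hL fun r => ?_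
  set Y := conjR (hol V₀ q (seg κ L)) (tsum V₀ A (q + (L : ℤ) • e κ) (treeWord (boxVec L r))) with hY
  have hYn : ‖Y‖ ≤ d * L * a :=
    (norm_conjR_le (hol_mem hV₀ _ _) _).trans (norm_tsum_treeWord_le L hV₀ ha hA _ r)
  have h1 := norm_conjR_expUnit_sub_self_le hX hε Y
  have h2 := norm_conjR_sub_self_le (Wcx_mem L hV₀ q κ (boxVec L r)) (hW r) Y
  have h := norm_sub_le (conjR (expUnit (Xavg L V₀ q κ)) Y - Y) (conjR (Wcx L V₀ q κ (boxVec L r)) Y - Y)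
  rw [sub_sub_sub_cancel_right] at h
  have h82 : 8 * ε * ‖Y‖ + 2 * ε * ‖Y‖ ≤ 10 * d * ε * L * a := by nlinarith
  linarith

include hV₀ ha hA hL hε0 hε hW in
/-- **(126) — THE LINEAR PART IS THE MAIN TERM UP TO `O(ε)`**: for a background `V₀` with `‖V₀(b)‖, ‖V₀(b)⁻¹‖ ≤ 1` whose
block loops satisfy `‖W_x(V₀) − 1‖ ≤ ε ≤ 1∕8` (the regime (109) via Prop. 1: `ε = O(L²α₀)`) and `|A_b| ≤ a`:
`‖L(Q(V₀)A)_c − L·(Q₀A)_c‖ ≤ 50(d+1)·ε·L·a` — "The remaining terms are small because the functions g(−z), g⁻¹(z), e^{iz}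
are equal to 1 for z = 0, so the operators occurring in these terms can be estimated by O(L²α₀) and the terms can be
estimated by O(1)L²α₀L|A|". [cite: Balaban1985Averaging, (124)–(126) p.36] -/
theorem norm_linQcov_sub_main_le :
    ‖linQcov L V₀ A q κ - (L : ℝ) • Q0cov L V₀ A q κ‖ ≤ 50 * (d + 1) * ε * L * a := by
  have hW1 : ∀ r : Fin d → Fin L, ‖((Wcx L V₀ q κ (boxVec L r) : 𝔸ˣ) : 𝔸) - 1‖ < 1 :=
    fun r => (hW r).trans_lt (by linarith)
  have h1 := norm_bracket1_le L hV₀ ha hA hL q κ hε0 hε hW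
  have h2 := norm_bracket2_le L hV₀ hA hL q κ hε0 hε hW
  have h3 := norm_bracket3_le L hV₀ ha hA hL q κ hε0 hε hW
  rw [linQcov_split L hL V₀ A q κ hW1, add_assoc, add_assoc, add_sub_cancel_left]
  refine (norm_add_le _ _).trans ?_
  refine (add_le_add h1 ((norm_add_le _ _).trans (add_le_add h2 h3))).trans ?_
  have hd : (0 : ℝ) ≤ d := Nat.cast_nonneg d
  nlinarith

include hV₀ ha hA hL hε0 hε hW in
/-- **(126)**: "|(Q(V₀)A)_c| ≤ |A| + O(1)L²α₀|A| < (1 + O(1)L²α₀)α₁" — here `‖L(Q(V₀)A)_c‖ ≤ (1 + 50(d+1)ε)·L·a`, i.e. for the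
`L^{−(d+1)}`-normalised linear form `|(Q(V₀)A)_c| ≤ (1 + 50(d+1)ε)|A|`, with `ε` the loop regularity of the background
(`= 16(d+1)(d+4)L²α₀` under (109) by `B7Prop2Explicit.norm_Wcx_sub_one_le`) — the `O(1)` made explicit as `50(d+1)·ε∕(L²α₀)`.
[cite: Balaban1985Averaging, (126) p.36] -/
theorem norm_linQcov_le : ‖linQcov L V₀ A q κ‖ ≤ (1 + 50 * (d + 1) * ε) * (L * a) := by
  have hmain : ‖(L : ℝ) • Q0cov L V₀ A q κ‖ ≤ L * a := by
    rw [norm_smul, Real.norm_of_nonneg (Nat.cast_nonneg L)]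
    exact mul_le_mul_of_nonneg_left (norm_Q0cov_le L hL hV₀ hA q κ) (Nat.cast_nonneg L)
  have h := norm_linQcov_sub_main_le L hV₀ ha hA hL q κ hε0 hε hW
  have h' := norm_add_le (linQcov L V₀ A q κ - (L : ℝ) • Q0cov L V₀ A q κ) ((L : ℝ) • Q0cov L V₀ A q κ)
  rw [sub_add_cancel] at h'
  nlinarith

include hV₀ ha hA in
/-- **(126) FROM THE PLAQUETTE REGULARITY (109)**: if `|V₀(∂p) − 1| ≤ α₀` for all plaquettes (b07's `plaqWord`) with
`512(d+1)(d+4)L²α₀ ≤ 1` and `16(d+1)(d+4)L²α₀ ≤ 1∕8`, then `‖L(Q(V₀)A)_c‖ ≤ (1 + 800(d+1)²(d+4)L²α₀)·L·a` — the printed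
`(1 + O(1)L²α₀)` with `O(1) = 800(d+1)²(d+4)` (`B7Prop2Explicit.norm_Wcx_sub_one_le` BY NAME for `ε = 16(d+1)(d+4)L²α₀`).
[cite: Balaban1985Averaging, (126) p.36, (109) p.34] -/
theorem norm_linQcov_le_of_plaquettes (hL : 1 ≤ L) (q : Site d) (κ : Fin d) {α₀ : ℝ} (hα₀ : 0 ≤ α₀)
    (hsmall : 512 * (d + 1) * (d + 4) * (L : ℝ) ^ 2 * α₀ ≤ 1)
    (hsmall' : 16 * (d + 1) * (d + 4) * (L : ℝ) ^ 2 * α₀ ≤ 1 / 8)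
    (h44 : ∀ (x : Site d) (κ κ' : Fin d), κ ≠ κ' → ‖((hol V₀ x (plaqWord κ κ') : 𝔸ˣ) : 𝔸) - 1‖ ≤ α₀) :
    ‖linQcov L V₀ A q κ‖ ≤ (1 + 800 * (d + 1) ^ 2 * (d + 4) * (L : ℝ) ^ 2 * α₀) * (L * a) := by
  have hWε : ∀ r : Fin d → Fin L,
      ‖((Wcx L V₀ q κ (boxVec L r) : 𝔸ˣ) : 𝔸) - 1‖ ≤ 16 * (d + 1) * (d + 4) * (L : ℝ) ^ 2 * α₀ := fun r =>
    (B7Prop2Explicit.norm_Wcx_sub_one_le L hL V₀ hV₀ hα₀ hsmall h44 q κ r).trans (le_of_eq (by ring))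
  have h := norm_linQcov_le L hV₀ ha hA hL q κ (by positivity) hsmall' hWε
  refine h.trans (le_of_eq ?_)
  ring

end Bound

end Literature.MathematicalPhysics.QuantumFieldTheory.Balaban1983to89.B7Prop3GeneralLinearBound

end
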